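import Summits.CriticalPhenomena.PercolationContinuityZ3.Theses.PercLowPointHalfSpace
import Summits.CriticalPhenomena.PercolationContinuityZ3.Theorems.BoundaryTwoArmDecay.Negative.LoadBearing
import Summits.CriticalPhenomena.PercolationContinuityZ3.Theorems.PercLowPointHalfSpaceLowPointIdentityShift
import Literature.Probability.Percolation.RSW
import Literature.Probability.Percolation.BondPercolationSymmetry
import Literature.Probability.Percolation.HalfSpacePinnedPairs
import Literature.Probability.Percolation.SitePaths
import Literature.Probability.Percolation.SharpnessDCTProofs

/-!
# Stub `stub_forest` of crux `BoundaryTwoArmDecay` (stmt-CriticalPhenomena-0911), part 1: definitions and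
# elementary algebra

Helper file for the stub `stub_forest` (the merge-forest inequality, THE LEVER of line
`merge-forest-level-bridges`) of the crux skeleton `Cruxes/BoundaryTwoArmDecay/Lines/merge_forest_level_bridges.lean`
(crux `PercLowPointHalfSpace.BoundaryTwoArmDecay`, stmt-CriticalPhenomena-0911); lands with
`--supports stmt-CriticalPhenomena-0911` (registered def-free sub-goal `stub_forest_sides`).  Parts 2–4 are `…StubForestNodes`,
`…StubForestPieces`, `…StubForestCharge`; the stub itself is `…StubForest`.

This part contains ALL the definitions of the proof:

* the objects of the line, re-declared with the SAME bodies as in the skeleton (so that the registered stub is their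
  unfolding): `Hge t = {z | t ≤ z 0}` (`H_t`), `fl x = s(x, x + e)` (floor edge, `e = (0,1,0)`), the event
  `BigAbove h t u`, the ♭-level-bridge event `LBflatAt r h x` (with `BigAbove` unfolded, as registered),
  `Dpieces r h ω = sSup (Dset r h ω)` (packing number of disjoint macroscopic open pieces in `ℍ ∩ B_{5r}`) and
  `Nchain r h ω = sSup (Nset r h ω)` (longest series chain of ♭-bridges);
* the level clusters `K ω s z = {w | z ↔ w in H_s}`, the `h`-big sets `Big h`, the window `Bw r = ℍ ∩ B_{2r+1}`;
* the HEIGHT FOREST of a configuration: `nodes ω r h` = pairs `(s, C)`, `0 ≤ s ≤ r+1`, `C` an `h`-big `H_s`-cluster of a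
  window vertex; `gen` (a window generator of a node), `minimals` (childless nodes), `Mset n` (minimal nodes below `n`),
  `rank` / `minM n` (an injective ranking of the minimal nodes / the least-ranked one below `n`), `dch n` (the DESIGNATED
  child: the child containing `minM n`), `piece n` (a macroscopic open piece inside the node);
* the ♭-roots: `Rset r = [0,r)³`, the two ♭-witnesses `um`, `up` of a ♭-root, its node `nd`, its two children `cm`, `cp`
  (the `H_{t+1}`-clusters of the witnesses), the CHARGED child `Cx` (the one separated by the bridge from the designated
  child) and the charging map `Φ x = minM (Cx x)` into minimal nodes;

and the elementary deterministic algebra: the floor edge; the events `{x ↔ y in S}` (closing an edge with an endpoint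
outside `S` does not affect them; the two SIDES of a bridge — the sub-goal); level clusters are equivalence classes,
monotone in the level and LAMINAR across levels; bigness.

Proof outline (parts 2–5): (STEP 1) `P(LB♭_x) = P(LB♭_0)` by translation invariance; (STEP 2) pathwise, for a lattice
configuration, `#{x ∈ [0,r)³ | LB♭_x} ≤ Nchain · Dpieces`: `Φ` has fibres of size `≤ Nchain` (a fibre is a series chain
of bridges separating `gen (dch n)` from `gen (Cx x)`, by the designated-child injection `(n, c) ↦ minM c`, `c ≠ dch n`)
and its image consists of pairwise vertex-disjoint minimal nodes, each containing a piece, hence `≤ Dpieces`;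
(STEP 3) integrate.  References: G. Grimmett, *Percolation* (1999), §1.3, §1.6, §7.2 (paths "in `A`").
-/

noncomputable section

namespace Summit.CriticalPhenomena.PercolationContinuityZ3.Theorems.BoundaryTwoArmDecay

open MeasureTheory
open Literature.Probability.Percolation Literature.Probability.LatticeModels
open Summit.CriticalPhenomena.PercolationContinuityZ3.Theorems.BoundaryTwoArmDecay.Negative (H e μ)

namespace StubForest

variable {ω : BondConfig (Site 3)} {r h : ℕ}

/-! ### The objects of the line (same bodies as in the skeleton) -/

/-- The upper half-space above level `t`: `H_t = {z | t ≤ z 0}` (`H_0 = ℍ`). -/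
abbrev Hge (t : ℤ) : Set (Site 3) := {z : Site 3 | t ≤ z 0}

/-- The floor edge `f_x = {x, x + e}` rooted at `x`. -/
abbrev fl (x : Site 3) : Sym2 (Site 3) := s(x, x + e)

/-- The event `BigAbove h t u`: the open cluster of `u` inside `H_{t+1}` has sup-diameter `≥ h`
(two of its vertices differ by `≥ h` in some coordinate). -/
def BigAbove (h : ℕ) (t : ℤ) (u : Site 3) : Set (BondConfig (Site 3)) :=
  {ω | ∃ v w : Site 3, ω ∈ openConnIn (Hge (t + 1)) u v ∧ ω ∈ openConnIn (Hge (t + 1)) u w ∧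
    ∃ i : Fin 3, (h : ℤ) ≤ |v i - w i|}

/-- `LB♭(r,h)` at root `x` (level `t = x 0`): the floor edge `f_x` is open, it is a bridge of the
`H_t`-cluster of `x`, and each side of the bridge contains, within `B_r` of its root, a vertex whose
`H_{t+1}`-cluster is `h`-big (the skeleton's body with `BigAbove` unfolded). -/
def LBflatAt (r h : ℕ) (x : Site 3) : Set (BondConfig (Site 3)) :=
  {ω | fl x ∈ ω ∧ ω \ {fl x} ∉ openConnIn (Hge (x 0)) x (x + e) ∧
    (∃ u : Site 3, u - x ∈ box 3 r ∧ ω \ {fl x} ∈ openConnIn (Hge (x 0)) x u ∧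
      ∃ v w : Site 3, ω ∈ openConnIn (Hge (x 0 + 1)) u v ∧ ω ∈ openConnIn (Hge (x 0 + 1)) u w ∧
        ∃ i : Fin 3, (h : ℤ) ≤ |v i - w i|) ∧
    (∃ u : Site 3, u - (x + e) ∈ box 3 r ∧ ω \ {fl x} ∈ openConnIn (Hge (x 0)) (x + e) u ∧
      ∃ v w : Site 3, ω ∈ openConnIn (Hge (x 0 + 1)) u v ∧ ω ∈ openConnIn (Hge (x 0 + 1)) u w ∧
        ∃ i : Fin 3, (h : ℤ) ≤ |v i - w i|)}

/-- Membership in `LBflatAt`, with the two ♭-witness clauses written through `BigAbove` (definitional). -/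
theorem mem_LBflatAt_iff {r h : ℕ} {x : Site 3} {ω : BondConfig (Site 3)} :
    ω ∈ LBflatAt r h x ↔ fl x ∈ ω ∧ ω \ {fl x} ∉ openConnIn (Hge (x 0)) x (x + e) ∧
      (∃ u : Site 3, u - x ∈ box 3 r ∧ ω \ {fl x} ∈ openConnIn (Hge (x 0)) x u ∧ ω ∈ BigAbove h (x 0) u) ∧
      (∃ u : Site 3, u - (x + e) ∈ box 3 r ∧ ω \ {fl x} ∈ openConnIn (Hge (x 0)) (x + e) u ∧
        ω ∈ BigAbove h (x 0) u) :=
  Iff.rfl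

/-- The defining set of `Dpieces`: the admissible numbers `k` of pairwise disjoint self-connected open
pieces inside `ℍ ∩ B_{5r}`, each with two points `u, v`, `2|u i - v i| ≥ h`. -/
def Dset (r h : ℕ) (ω : BondConfig (Site 3)) : Set ℕ :=
  {k : ℕ | ∃ S : Fin k → Finset (Site 3),
    (∀ a, (↑(S a) : Set (Site 3)) ⊆ {z : Site 3 | 0 ≤ z 0} ∩ ↑(box 3 (5 * r))) ∧
    (∀ a, ∀ u ∈ S a, ∀ v ∈ S a, ω ∈ openConnIn (↑(S a) : Set (Site 3)) u v) ∧
    (∀ a, ∃ u ∈ S a, ∃ v ∈ S a, ∃ i : Fin 3, (h : ℤ) ≤ 2 * |u i - v i|) ∧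
    (∀ a b, a ≠ b → Disjoint (S a) (S b))}

/-- `D(r,h)(ω)`: the packing number of macroscopic open pieces in `ℍ ∩ B_{5r}`. -/
def Dpieces (r h : ℕ) (ω : BondConfig (Site 3)) : ℕ :=
  sSup {k : ℕ | ∃ S : Fin k → Finset (Site 3),
    (∀ a, (↑(S a) : Set (Site 3)) ⊆ {z : Site 3 | 0 ≤ z 0} ∩ ↑(box 3 (5 * r))) ∧
    (∀ a, ∀ u ∈ S a, ∀ v ∈ S a, ω ∈ openConnIn (↑(S a) : Set (Site 3)) u v) ∧
    (∀ a, ∃ u ∈ S a, ∃ v ∈ S a, ∃ i : Fin 3, (h : ℤ) ≤ 2 * |u i - v i|) ∧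
    (∀ a b, a ≠ b → Disjoint (S a) (S b))}

/-- The defining set of `Nchain`: the admissible lengths `m` of series chains of ♭-bridges. -/
def Nset (r h : ℕ) (ω : BondConfig (Site 3)) : Set ℕ :=
  {m : ℕ | ∃ t : ℤ, ∃ u v : Site 3, ∃ x : Fin m → Site 3, Function.Injective x ∧ 0 ≤ t ∧
    ∀ a, x a 0 = t ∧ x a ∈ box 3 r ∧ ω ∈ LBflatAt r h (x a) ∧
      ω ∈ openConnIn (Hge t) u v ∧ ω \ {fl (x a)} ∉ openConnIn (Hge t) u v}

/-- `N(r,h)(ω)`: the longest series chain of ♭-bridges at a common level. -/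
def Nchain (r h : ℕ) (ω : BondConfig (Site 3)) : ℕ :=
  sSup {m : ℕ | ∃ t : ℤ, ∃ u v : Site 3, ∃ x : Fin m → Site 3, Function.Injective x ∧ 0 ≤ t ∧
    ∀ a, x a 0 = t ∧ x a ∈ box 3 r ∧ ω ∈ LBflatAt r h (x a) ∧
      ω ∈ openConnIn (Hge t) u v ∧ ω \ {fl (x a)} ∉ openConnIn (Hge t) u v}

/-! ### The floor edge -/

/-- The coordinates of `e` are `0` or `1`. -/
theorem e_apply_mem (j : Fin 3) : (e : Site 3) j = 0 ∨ (e : Site 3) j = 1 := by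
  rcases eq_or_ne j 1 with rfl | hj
  · exact Or.inr (by simp [e])
  · exact Or.inl (by simp [e, Pi.single_eq_of_ne hj])

/-- `x + e` has the height of `x`. -/
theorem add_e_zero (x : Site 3) : (x + e) 0 = x 0 := by
  simp [e]

/-- `x ≠ x + e`. -/
theorem ne_add_e (x : Site 3) : x ≠ x + e := by
  intro h
  exact Negative.e_ne_zero (left_eq_add.1 h)

/-! ### Algebra of the events `{x ↔ y in S}` -/

/-- The left endpoint of `{x ↔ y in S}` lies in `S`. -/
theorem left_mem_of_conn {V : Type*} {S : Set V} {x y : V} {ω : BondConfig V} (h : ω ∈ openConnIn S x y) :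
    x ∈ S := h.1

/-- The right endpoint of `{x ↔ y in S}` lies in `S`. -/
theorem right_mem_of_conn {V : Type*} {S : Set V} {x y : V} {ω : BondConfig V} (h : ω ∈ openConnIn S x y) :
    y ∈ S := h.2.1

/-- **Closing an edge with an endpoint outside `S`** does not affect `{x ↔ y in S}`. -/
theorem diff_conn_of_notMem {V : Type*} {S : Set V} {p q x y : V} {ω : BondConfig V} (hp : p ∉ S)
    (h : ω ∈ openConnIn S x y) : ω \ {s(p, q)} ∈ openConnIn S x y := by
  refine DCT16.mem_openConnIn_of_pathIn (DCT16.pathIn_congrGraph ?_ (DCT16.pathIn_of_mem_openConnIn h))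
  intro a b ha hb hab
  rw [openGraph_adj] at hab ⊢
  refine ⟨⟨hab.1, ?_⟩, hab.2⟩
  rw [Set.mem_singleton_iff, Sym2.eq_iff]
  rintro (⟨rfl, -⟩ | ⟨-, rfl⟩)
  · exact hp ha
  · exact hp hb

/-- **The two sides of an edge.** If `p ↔ w in S` and `p, q ∈ S`, then after closing `f = {p, q}` the
vertex `w` is still joined in `S` to `p` or to `q`. -/
theorem side_total {V : Type*} {S : Set V} {p q w : V} {ω : BondConfig V} (hq : q ∈ S)
    (h : ω ∈ openConnIn S p w) :
    ω \ {s(p, q)} ∈ openConnIn S p w ∨ ω \ {s(p, q)} ∈ openConnIn S q w := by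
  have hp : p ∈ S := left_mem_of_conn h
  refine DCT16.pathIn_induction
    (fun w => ω \ {s(p, q)} ∈ openConnIn S p w ∨ ω \ {s(p, q)} ∈ openConnIn S q w)
    (DCT16.pathIn_of_mem_openConnIn h) (Or.inl (LowPoint.conn_refl _ hp)) ?_
  intro a b ha hb hPa hab
  by_cases hf : s(a, b) = s(p, q)
  · rcases Sym2.eq_iff.1 hf with ⟨-, rfl⟩ | ⟨-, rfl⟩
    · exact Or.inr (LowPoint.conn_refl _ hq)
    · exact Or.inl (LowPoint.conn_refl _ hp)
  · have hab' : (openGraph (ω \ {s(p, q)})).Adj a b := by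
      rw [openGraph_adj] at hab ⊢
      exact ⟨⟨hab.1, hf⟩, hab.2⟩
    have hab'' : ω \ {s(p, q)} ∈ openConnIn S a b := DCT16.mem_openConnIn_of_pathIn (PathIn.of_adj ha hb hab')
    rcases hPa with h1 | h1
    · exact Or.inl (LowPoint.conn_trans h1 hab'')
    · exact Or.inr (LowPoint.conn_trans h1 hab'')

/-- **A bridge separates.** If `f = {p, q}` is a bridge (`p ↮ q in S` once `f` is closed), no vertex is on
both sides. -/
theorem side_disjoint {V : Type*} {S : Set V} {p q w : V} {ω : BondConfig V}
    (hbr : ω \ {s(p, q)} ∉ openConnIn S p q) (h1 : ω \ {s(p, q)} ∈ openConnIn S p w)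
    (h2 : ω \ {s(p, q)} ∈ openConnIn S q w) : False :=
  hbr (LowPoint.conn_trans h1 (LowPoint.conn_symm h2))

/-! ### Level clusters -/

/-- The `H_s`-cluster of `z`: `K ω s z = {w | z ↔ w in H_s}` (empty if `z ∉ H_s`; possibly infinite). -/
def K (ω : BondConfig (Site 3)) (s : ℤ) (z : Site 3) : Set (Site 3) := {w | ω ∈ openConnIn (Hge s) z w}

/-- A level cluster lies in its half-space. -/
theorem K_subset_Hge (ω : BondConfig (Site 3)) (s : ℤ) (z : Site 3) : K ω s z ⊆ Hge s :=
  fun _ hw => right_mem_of_conn hw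

/-- A vertex of `H_s` lies in its own `H_s`-cluster. -/
theorem self_mem_K {ω : BondConfig (Site 3)} {s : ℤ} {z : Site 3} (hz : z ∈ Hge s) : z ∈ K ω s z :=
  LowPoint.conn_refl _ hz

/-- A vertex with a nonempty `H_s`-cluster lies in it. -/
theorem self_mem_K_of_mem {ω : BondConfig (Site 3)} {s : ℤ} {z w : Site 3} (hw : w ∈ K ω s z) :
    z ∈ K ω s z :=
  self_mem_K (left_mem_of_conn hw)

/-- Level clusters are equivalence classes: a cluster is the cluster of each of its vertices. -/
theorem K_eq_of_mem {ω : BondConfig (Site 3)} {s : ℤ} {z w : Site 3} (hw : w ∈ K ω s z) :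
    K ω s w = K ω s z := by
  ext y
  exact ⟨fun hy => LowPoint.conn_trans hw hy, fun hy => LowPoint.conn_trans (LowPoint.conn_symm hw) hy⟩

/-- Level clusters shrink as the level rises. -/
theorem K_mono {ω : BondConfig (Site 3)} {s s' : ℤ} (h : s ≤ s') (z : Site 3) : K ω s' z ⊆ K ω s z :=
  fun _ hw => LowPoint.conn_mono (LowPoint.level_antitone h) hw

/-- **Laminarity.** Two level clusters of levels `s ≤ s'` sharing a vertex are nested. -/
theorem K_laminar {ω : BondConfig (Site 3)} {s s' : ℤ} (h : s ≤ s') {z z' w : Site 3}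
    (hw' : w ∈ K ω s' z') (hw : w ∈ K ω s z) : K ω s' z' ⊆ K ω s z := by
  rw [← K_eq_of_mem hw', ← K_eq_of_mem hw]
  exact K_mono h w

/-- Two level clusters of the same level sharing a vertex are equal. -/
theorem K_eq_of_mem_of_mem {ω : BondConfig (Site 3)} {s : ℤ} {z z' w : Site 3}
    (hw' : w ∈ K ω s z') (hw : w ∈ K ω s z) : K ω s z' = K ω s z := by
  rw [← K_eq_of_mem hw', ← K_eq_of_mem hw]

/-! ### `h`-bigness -/

/-- The `h`-big vertex sets: two of their points differ by `≥ h` in some coordinate. -/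
def Big (h : ℕ) : Set (Set (Site 3)) := {C | ∃ a ∈ C, ∃ b ∈ C, ∃ i : Fin 3, (h : ℤ) ≤ |a i - b i|}

/-- Bigness is monotone. -/
theorem big_mono {h : ℕ} {C C' : Set (Site 3)} (hC : C ∈ Big h) (hCC' : C ⊆ C') : C' ∈ Big h := by
  obtain ⟨a, ha, b, hb, i, hi⟩ := hC
  exact ⟨a, hCC' ha, b, hCC' hb, i, hi⟩

/-- A big set is nonempty. -/
theorem nonempty_of_big {h : ℕ} {C : Set (Site 3)} (hC : C ∈ Big h) : C.Nonempty := by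
  obtain ⟨a, ha, -⟩ := hC
  exact ⟨a, ha⟩

/-- `ω ∈ BigAbove h t u` makes the `H_{t+1}`-cluster of `u` big (and puts `u` in it). -/
theorem big_K_of_bigAbove {h : ℕ} {t : ℤ} {u : Site 3} {ω : BondConfig (Site 3)}
    (hu : ω ∈ BigAbove h t u) : K ω (t + 1) u ∈ Big h ∧ u ∈ K ω (t + 1) u := by
  obtain ⟨v, w, hv, hw, i, hi⟩ := hu
  exact ⟨⟨v, hv, w, hw, i, hi⟩, self_mem_K (left_mem_of_conn hv)⟩

/-! ### The height forest: window, nodes, minimal nodes, designated children (definitions) -/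

/-- The finite window `B = ℍ ∩ B_{2r+1}` met by every node. -/
def Bw (r : ℕ) : Finset (Site 3) := (box 3 (2 * r + 1)).filter fun z => 0 ≤ z 0

/-- Membership in the window. -/
theorem mem_Bw {r : ℕ} {z : Site 3} :
    z ∈ Bw r ↔ (∀ i, -((2 * r + 1 : ℕ) : ℤ) ≤ z i ∧ z i ≤ (2 * r + 1 : ℕ)) ∧ 0 ≤ z 0 := by
  rw [Bw, Finset.mem_filter, mem_box]

open scoped Classical in
/-- The NODES of the height forest: pairs `(s, C)` with `0 ≤ s ≤ r + 1` and `C` an `h`-big `H_s`-cluster of a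
vertex of the window. -/
def nodes (ω : BondConfig (Site 3)) (r h : ℕ) : Finset (ℤ × Set (Site 3)) :=
  (((Finset.Icc (0 : ℤ) (r + 1)) ×ˢ Bw r).image fun p => (p.1, K ω p.1 p.2)).filter fun n => n.2 ∈ Big h

/-- Membership in `nodes`. -/
theorem mem_nodes_iff {n : ℤ × Set (Site 3)} :
    n ∈ nodes ω r h ↔ 0 ≤ n.1 ∧ n.1 ≤ r + 1 ∧ n.2 ∈ Big h ∧ ∃ z ∈ Bw r, n.2 = K ω n.1 z := by
  classical
  simp only [nodes, Finset.mem_filter, Finset.mem_image, Finset.mem_product, Finset.mem_Icc, Prod.exists]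
  constructor
  · rintro ⟨⟨s, z, ⟨⟨hs0, hs1⟩, hz⟩, rfl⟩, hbig⟩
    exact ⟨hs0, hs1, hbig, z, hz, rfl⟩
  · rintro ⟨h0, h1, hbig, z, hz, hK⟩
    refine ⟨⟨n.1, z, ⟨⟨h0, h1⟩, hz⟩, ?_⟩, hbig⟩
    rw [← hK]

/-- A generator of a node inside the window (junk `0` off `nodes`). -/
def gen (ω : BondConfig (Site 3)) (r : ℕ) (n : ℤ × Set (Site 3)) : Site 3 :=
  if hn : ∃ z ∈ Bw r, n.2 = K ω n.1 z then hn.choose else 0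

open scoped Classical in
/-- The MINIMAL nodes: nodes `(s, C)` without a child node `(s + 1, C')`, `C' ⊆ C`. -/
def minimals (ω : BondConfig (Site 3)) (r h : ℕ) : Finset (ℤ × Set (Site 3)) :=
  (nodes ω r h).filter fun n => ∀ c ∈ nodes ω r h, ¬ (c.1 = n.1 + 1 ∧ c.2 ⊆ n.2)

/-- Membership in `minimals`. -/
theorem mem_minimals_iff {m : ℤ × Set (Site 3)} :
    m ∈ minimals ω r h ↔ m ∈ nodes ω r h ∧ ∀ c ∈ nodes ω r h, ¬ (c.1 = m.1 + 1 ∧ c.2 ⊆ m.2) := by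
  classical
  rw [minimals, Finset.mem_filter]

open scoped Classical in
/-- The minimal nodes below a node (same or higher level, inside it). -/
def Mset (ω : BondConfig (Site 3)) (r h : ℕ) (n : ℤ × Set (Site 3)) : Finset (ℤ × Set (Site 3)) :=
  (minimals ω r h).filter fun m => n.1 ≤ m.1 ∧ m.2 ⊆ n.2

/-- Membership in `Mset`. -/
theorem mem_Mset_iff {n m : ℤ × Set (Site 3)} :
    m ∈ Mset ω r h n ↔ m ∈ minimals ω r h ∧ n.1 ≤ m.1 ∧ m.2 ⊆ n.2 := by
  classical
  rw [Mset, Finset.mem_filter]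

/-- An injective ranking of the minimal nodes (junk `0` off `minimals`). -/
def rank (ω : BondConfig (Site 3)) (r h : ℕ) (m : ℤ × Set (Site 3)) : ℕ :=
  if hm : m ∈ minimals ω r h then ((minimals ω r h).equivFin ⟨m, hm⟩ : ℕ) else 0

/-- The DESIGNATED minimal node below `n`: the one of least rank (junk `n` if there is none). -/
def minM (ω : BondConfig (Site 3)) (r h : ℕ) (n : ℤ × Set (Site 3)) : ℤ × Set (Site 3) :=
  if hn : (Mset ω r h n).Nonempty then (Finset.exists_min_image (Mset ω r h n) (rank ω r h) hn).choose
  else n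

/-- The DESIGNATED CHILD of a node: the `H_{s+1}`-cluster of the generator of its designated minimal node. -/
def dch (ω : BondConfig (Site 3)) (r h : ℕ) (n : ℤ × Set (Site 3)) : ℤ × Set (Site 3) :=
  (n.1 + 1, K ω (n.1 + 1) (gen ω r (minM ω r h n)))

open scoped Classical in
/-- A PIECE inside a node (junk `∅` if there is none). -/
def piece (ω : BondConfig (Site 3)) (r h : ℕ) (n : ℤ × Set (Site 3)) : Finset (Site 3) :=
  if hS : ∃ S : Finset (Site 3), (↑S : Set (Site 3)) ⊆ {z : Site 3 | 0 ≤ z 0} ∩ ↑(box 3 (5 * r)) ∧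
      (∀ a ∈ S, ∀ b ∈ S, ω ∈ openConnIn (↑S : Set (Site 3)) a b) ∧
      (∃ u ∈ S, ∃ v ∈ S, ∃ i : Fin 3, (h : ℤ) ≤ 2 * |u i - v i|) ∧ (↑S : Set (Site 3)) ⊆ n.2
  then hS.choose else ∅

/-! ### The ♭-roots and the charging map (definitions) -/

/-- The set of roots `R = [0, r)³` over which the ♭-events are counted (`|R| = r³`). -/
def Rset (r : ℕ) : Finset (Site 3) := Fintype.piFinset fun _ : Fin 3 => Finset.Ico (0 : ℤ) r

/-- Membership in `Rset`. -/
theorem mem_Rset {x : Site 3} : x ∈ Rset r ↔ ∀ j, 0 ≤ x j ∧ x j < r := by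
  simp [Rset, Fintype.mem_piFinset]

open scoped Classical in
/-- The ♭-witness on the `x`-side (junk `0` off the event). -/
def um (ω : BondConfig (Site 3)) (r h : ℕ) (x : Site 3) : Site 3 :=
  if hx : ω ∈ LBflatAt r h x then hx.2.2.1.choose else 0

open scoped Classical in
/-- The ♭-witness on the `x + e`-side (junk `0` off the event). -/
def up (ω : BondConfig (Site 3)) (r h : ℕ) (x : Site 3) : Site 3 :=
  if hx : ω ∈ LBflatAt r h x then hx.2.2.2.choose else 0

/-- The node of a root: its `H_t`-cluster, `t = x 0`. -/
def nd (ω : BondConfig (Site 3)) (x : Site 3) : ℤ × Set (Site 3) := (x 0, K ω (x 0) x)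

/-- The `x`-side child of the node of a ♭-root. -/
def cm (ω : BondConfig (Site 3)) (r h : ℕ) (x : Site 3) : ℤ × Set (Site 3) :=
  (x 0 + 1, K ω (x 0 + 1) (um ω r h x))

/-- The `x + e`-side child of the node of a ♭-root. -/
def cp (ω : BondConfig (Site 3)) (r h : ℕ) (x : Site 3) : ℤ × Set (Site 3) :=
  (x 0 + 1, K ω (x 0 + 1) (up ω r h x))

open scoped Classical in
/-- The CHARGED child of a ♭-root: the one of `cm`, `cp` separated by the bridge from the designated child. -/
def Cx (ω : BondConfig (Site 3)) (r h : ℕ) (x : Site 3) : ℤ × Set (Site 3) :=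
  if ω \ {fl x} ∈ openConnIn (Hge (x 0)) x (gen ω r (dch ω r h (nd ω x))) then cp ω r h x else cm ω r h x

/-- The minimal node to which a ♭-root is charged. -/
def Φ (ω : BondConfig (Site 3)) (r h : ℕ) (x : Site 3) : ℤ × Set (Site 3) := minM ω r h (Cx ω r h x)

/-! ### Registered sub-goal -/

/-- **Registered sub-goal `stub_forest_sides`** (def-free): the two SIDES of a bridge `{p, q}` of `{· ↔ · in S}` —
every vertex joined to `p` in `S` is, after closing the bridge, joined to exactly one of `p`, `q`. -/
theorem stub_forest_sides : ∀ (S : Set (Site 3)) (p q w : Site 3) (ω : BondConfig (Site 3)), q ∈ S → ω ∈ openConnIn S p w → ω \ {s(p, q)} ∉ openConnIn S p q → (ω \ {s(p, q)} ∈ openConnIn S p w ∨ ω \ {s(p, q)} ∈ openConnIn S q w) ∧ ¬ (ω \ {s(p, q)} ∈ openConnIn S p w ∧ ω \ {s(p, q)} ∈ openConnIn S q w) :=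
  fun _ _ _ _ _ hq h hbr => ⟨side_total hq h, fun h2 => side_disjoint hbr h2.1 h2.2⟩

end StubForest

end Summit.CriticalPhenomena.PercolationContinuityZ3.Theorems.BoundaryTwoArmDecay

end
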